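import Summits.ResolutionOfSingularities.ResolutionOfSingularities.Theorems.FrobeniusLadderFInjectiveMacaulayficationFibreIdealOfBasePoint
import HarnessLib

/-!
# The fibre ideal of a point of an affine base `Spec R`, in generators (`FibreIdealOfOrigin`, E7 N4c)

[OURS · L1 W4.5a] Support file for crux stmt-ResolutionOfSingularities-15315
(`FrobeniusLadder.FInjectiveMacaulayfication`), E7 two-level tower format (res-L1-w45a-plan-1 GO 10:30:01Z «N4c = the
`hXQ`-currency sibling» of `FibreIdealOfBasePoint`). For an AFFINE base `X = Spec R` (the specimen models
`R = k[x₁,…,xₙ] ⧸ (Gs)` of `RoadBFrame` / `T11PlusOriginTransport*`), the affine open `V = ⊤`, and a point `b` whose ideal is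
generated by a family `x : ι → R` (the origin: `b.asIdeal = (x̄₁,…,x̄ₙ)`), the fibre ideal `𝔭_b · Γ(X′, U)` of
`FibreIdealOfBasePoint` is GENERATED BY THE IMAGES OF THE `xⱼ`:

* `primeIdealOf_top_eq` / `primeIdealOf_top_asIdeal`: the prime of `Γ(Spec R, ⊤)` attached to `b` by the affine open `⊤` is
  `b` read through the canonical isomorphism `Γ(Spec R, ⊤) ≅ R` (`Scheme.ΓSpecIso`; its inverse is `algebraMap R Γ(Spec R, ⊤)`,
  `Scheme.ΓSpecIso_inv`), i.e. `𝔭_b = b.asIdeal · Γ(Spec R, ⊤)`;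
* `map_primeIdealOf_top_eq_span`: hence `𝔭_b · Γ(X′, U) = (π₁♯ x̄ⱼ)ⱼ · Γ(X′, U)` along `π₁.appLE ⊤ U`;
* `appLE_mem_of_over` (= the `hXQ` feeder of `cnChartClauseRel`): a chart point `z` of `Spec Γ(X′, U)` over `b` contains every
  `π₁♯ x̄ⱼ` (from `FibreIdealOfBasePoint.map_primeIdealOf_le`).

References: folklore bookkeeping over Mathlib's `AlgebraicGeometry.AffineScheme` API (`isAffineOpen_top`, `fromSpec_top`,
`Scheme.isoSpec_Spec_inv`, `IsAffineOpen.primeIdealOf`); no statement of Hironaka 2017 is used; no definition, no named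
fact; AI-written (AI review is weaker than expert review). [folklore]
-/

-- single-problem summit: the doubled namespace component `ResolutionOfSingularities` is forced
set_option linter.dupNamespace false

noncomputable section

namespace Summit.ResolutionOfSingularities.ResolutionOfSingularities.Theorems.FInjectiveMacaulayfication.FibreIdealOfOrigin

open AlgebraicGeometry CategoryTheory TopologicalSpace
open Summit.ResolutionOfSingularities.ResolutionOfSingularities.Theorems.FInjectiveMacaulayfication

/-- **The prime of `Γ(Spec R, ⊤)` attached to a point `b` by the affine open `⊤` is `b` transported along
`Γ(Spec R, ⊤) ≅ R`:** `𝔭_b = Spec (ΓSpecIso R).hom b`. [folklore] -/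
theorem primeIdealOf_top_eq (R : CommRingCat.{0}) (b : ↥(Spec R)) (hb : b ∈ (⊤ : (Spec R).Opens)) :
    (isAffineOpen_top (Spec R)).primeIdealOf ⟨b, hb⟩ = (Spec.map (Scheme.ΓSpecIso R).hom).base b := by
  -- `fromSpec` of the affine open `⊤ ⊆ Spec R` is `Spec (ΓSpecIso R).inv`, a left inverse of `Spec (ΓSpecIso R).hom`
  have hfrom : (isAffineOpen_top (Spec R)).fromSpec = Spec.map (Scheme.ΓSpecIso R).inv := by
    rw [IsAffineOpen.fromSpec_top, Scheme.isoSpec_Spec_inv]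
  have hcomp : Spec.map (Scheme.ΓSpecIso R).hom ≫ Spec.map (Scheme.ΓSpecIso R).inv = 𝟙 (Spec R) := by
    rw [← Spec.map_comp, Iso.inv_hom_id, Spec.map_id]
  have hbq : (isAffineOpen_top (Spec R)).fromSpec.base ((Spec.map (Scheme.ΓSpecIso R).hom).base b) = b := by
    rw [hfrom, ← Scheme.Hom.comp_apply, hcomp]
    rfl
  have key := PointCentreIdealSheaf.primeIdealOf_fromSpec (isAffineOpen_top (Spec R))
    ((Spec.map (Scheme.ΓSpecIso R).hom).base b) (hbq ▸ hb)
  -- transport the point `⟨fromSpec q, _⟩ = ⟨b, hb⟩`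
  have hpt : (⟨(isAffineOpen_top (Spec R)).fromSpec.base ((Spec.map (Scheme.ΓSpecIso R).hom).base b), hbq ▸ hb⟩ :
      (⊤ : (Spec R).Opens)) = ⟨b, hb⟩ := Subtype.ext hbq
  rw [hpt] at key
  exact key

/-- **`𝔭_b = b.asIdeal · Γ(Spec R, ⊤)`**: the ideal of the prime attached to `b` by the affine open `⊤` is the extension of
`b.asIdeal` along `(ΓSpecIso R).inv = algebraMap R Γ(Spec R, ⊤)`. [folklore] -/
theorem primeIdealOf_top_asIdeal (R : CommRingCat.{0}) (b : ↥(Spec R)) (hb : b ∈ (⊤ : (Spec R).Opens)) :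
    ((isAffineOpen_top (Spec R)).primeIdealOf ⟨b, hb⟩).asIdeal = b.asIdeal.map (Scheme.ΓSpecIso R).inv.hom := by
  rw [primeIdealOf_top_eq R b hb]
  -- `(Spec φ) b = φ⁻¹ b`; along the isomorphism `ΓSpecIso R` the contraction by `hom` is the extension by `inv`
  change b.asIdeal.comap (Scheme.ΓSpecIso R).hom.hom = b.asIdeal.map (Scheme.ΓSpecIso R).inv.hom
  apply le_antisymm
  · intro s hs
    rw [Ideal.mem_comap] at hs
    have : (Scheme.ΓSpecIso R).inv.hom ((Scheme.ΓSpecIso R).hom.hom s) = s := Iso.hom_inv_id_apply _ s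
    rw [← this]
    exact Ideal.mem_map_of_mem _ hs
  · rw [Ideal.map_le_iff_le_comap]
    intro a ha
    rw [Ideal.mem_comap, Ideal.mem_comap]
    have : (Scheme.ΓSpecIso R).hom.hom ((Scheme.ΓSpecIso R).inv.hom a) = a := Iso.inv_hom_id_apply _ a
    rw [this]
    exact ha

/-- **N4c — THE FIBRE IDEAL OF A POINT WITH GIVEN GENERATORS, IN GENERATORS.** For `π₁ : X′ ⟶ Spec R`, a point `b` with
`b.asIdeal = (xⱼ)ⱼ`, and an affine open `U` of `X′` (over `V = ⊤`): `𝔭_b · Γ(X′, U) = (π₁♯ (ΓSpecIso⁻¹ xⱼ))ⱼ · Γ(X′, U)`.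
Here `V` is spelled `⟨⊤, isAffineOpen_top (Spec R)⟩` so that the left side is literally the fibre ideal of
`FibreIdealOfBasePoint.map_primeIdealOf_le`. [folklore] -/
theorem map_primeIdealOf_top_eq_span (R : CommRingCat.{0}) {X' : Scheme.{0}} (π₁ : X' ⟶ Spec R) {ι : Type}
    (x : ι → R) (b : ↥(Spec R)) (hb0 : b.asIdeal = Ideal.span (Set.range x))
    (hb : b ∈ ((⟨⊤, isAffineOpen_top (Spec R)⟩ : (Spec R).affineOpens) : (Spec R).Opens)) (U : X'.affineOpens)
    (hUV : (U : X'.Opens) ≤ π₁ ⁻¹ᵁ ((⟨⊤, isAffineOpen_top (Spec R)⟩ : (Spec R).affineOpens) : (Spec R).Opens)) :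
    ((⟨⊤, isAffineOpen_top (Spec R)⟩ : (Spec R).affineOpens).2.primeIdealOf ⟨b, hb⟩).asIdeal.map
        (π₁.appLE ((⟨⊤, isAffineOpen_top (Spec R)⟩ : (Spec R).affineOpens) : (Spec R).Opens) U hUV).hom =
      Ideal.span (Set.range fun j : ι =>
        (π₁.appLE ((⟨⊤, isAffineOpen_top (Spec R)⟩ : (Spec R).affineOpens) : (Spec R).Opens) U hUV).hom
          ((Scheme.ΓSpecIso R).inv.hom (x j))) := by
  have h1 : ((⟨⊤, isAffineOpen_top (Spec R)⟩ : (Spec R).affineOpens).2.primeIdealOf ⟨b, hb⟩).asIdeal =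
      b.asIdeal.map (Scheme.ΓSpecIso R).inv.hom := primeIdealOf_top_asIdeal R b hb
  rw [h1, hb0, Ideal.map_span, Ideal.map_span, ← Set.range_comp, ← Set.range_comp]
  rfl

/-- **The `hXQ` feeder.** In the situation of `map_primeIdealOf_top_eq_span`, a chart point `z` of `Spec Γ(X′, U)` lying
over `b` contains every `π₁♯ (ΓSpecIso⁻¹ xⱼ)`. [folklore] -/
theorem appLE_mem_of_over (R : CommRingCat.{0}) {X' : Scheme.{0}} (π₁ : X' ⟶ Spec R) {ι : Type}
    (x : ι → R) (b : ↥(Spec R)) (hb0 : b.asIdeal = Ideal.span (Set.range x))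
    (hb : b ∈ ((⟨⊤, isAffineOpen_top (Spec R)⟩ : (Spec R).affineOpens) : (Spec R).Opens)) (U : X'.affineOpens)
    (hUV : (U : X'.Opens) ≤ π₁ ⁻¹ᵁ ((⟨⊤, isAffineOpen_top (Spec R)⟩ : (Spec R).affineOpens) : (Spec R).Opens))
    (z : ↥(Spec Γ(X', U))) (hz : π₁.base (U.2.fromSpec.base z) = b) (j : ι) :
    (π₁.appLE ((⟨⊤, isAffineOpen_top (Spec R)⟩ : (Spec R).affineOpens) : (Spec R).Opens) U hUV).hom
        ((Scheme.ΓSpecIso R).inv.hom (x j)) ∈ z.asIdeal := by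
  have hle := FibreIdealOfBasePoint.map_primeIdealOf_le π₁ b ⟨⊤, isAffineOpen_top (Spec R)⟩ hb U hUV z hz
  rw [map_primeIdealOf_top_eq_span R π₁ x b hb0 hb U hUV] at hle
  exact hle (Ideal.subset_span ⟨j, rfl⟩)

/-- The same feeder with `Γ(Spec R, ⊤)`-elements spelled through `algebraMap R Γ(Spec R, ⊤)`
(`= (ΓSpecIso R).inv`, `Scheme.ΓSpecIso_inv`). [folklore] -/
theorem appLE_algebraMap_mem_of_over (R : CommRingCat.{0}) {X' : Scheme.{0}} (π₁ : X' ⟶ Spec R) {ι : Type}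
    (x : ι → R) (b : ↥(Spec R)) (hb0 : b.asIdeal = Ideal.span (Set.range x))
    (hb : b ∈ ((⟨⊤, isAffineOpen_top (Spec R)⟩ : (Spec R).affineOpens) : (Spec R).Opens)) (U : X'.affineOpens)
    (hUV : (U : X'.Opens) ≤ π₁ ⁻¹ᵁ ((⟨⊤, isAffineOpen_top (Spec R)⟩ : (Spec R).affineOpens) : (Spec R).Opens))
    (z : ↥(Spec Γ(X', U))) (hz : π₁.base (U.2.fromSpec.base z) = b) (j : ι) :
    (π₁.appLE ((⟨⊤, isAffineOpen_top (Spec R)⟩ : (Spec R).affineOpens) : (Spec R).Opens) U hUV).hom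
        (algebraMap R Γ(Spec R, ⊤) (x j)) ∈ z.asIdeal :=
  appLE_mem_of_over R π₁ x b hb0 hb U hUV z hz j

end Summit.ResolutionOfSingularities.ResolutionOfSingularities.Theorems.FInjectiveMacaulayfication.FibreIdealOfOrigin

end
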